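import Literature.NumberTheory.Automorphic.QuaternionAdelicUnitsPlacesSplitting
import Literature.NumberTheory.Automorphic.QuaternionUnitsPlaceSplittingCentralizer
import Literature.MeasureTheory.Group.InvariantQuotientOrbitalPiProd
import HarnessLib

/-!
# Gelbart's (10.19) on the `Dˣ` side over a finite set `S` of finite places: the Haar measure and the
# orbital integrals of `Φ' = (⊗_{v ∈ S} f'_v) ⊗ Φ'^S` factor through `D_𝔸ˣ = D_Sˣ × D^{S,×}`
(Gelbart, *Automorphic forms on adele groups* (1975), §10, pp. 153–155, (10.14), (10.19); Bump
(1997), §3.3, Prop. 3.3.2)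

Topic `NumberTheory/Automorphic`; theorems only (no definition, no named fact, no instance visible
to importers). The multi-place form of `QuaternionUnitsPlaceSplittingCentralizer` (one place) and
the `Dˣ` twin of `GLnPlacesSplittingCentralizer`, along the splitting
`Quat.placesSplitting K D S : D_Sˣ × D^{S,×} ≃ₜ* D_𝔸ˣ` of `QuaternionAdelicUnitsPlacesSplitting`
(`D_Sˣ = Π_{v ∈ S} D_vˣ`, `D^{S,×} = {x : x_v = 1, v ∈ S}`). Gelbart (1975), p. 154, expands the
geometric side (10.14) of the trace formula for `G' = Dˣ` with the test function
`Φ'(g) = {Π_{v ∈ S} f'_v(g_v)} f * f^*(g^S)` (p. 153) exactly as (10.15) is expanded on p. 155 via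
(10.19): the orbital integral of `Φ'` is the product of the local orbital integrals of the `f'_v`
(`v ∈ S`) and the orbital integral of `f * f^*` over `B'^S \ G'^S`:

* `Quat.exists_map_placesSplitting_symm_eq_smul_prod` — **the Haar measure factors**:
  `(splitting⁻¹)_* ν = κ • ((⨂_{v ∈ S} μ_v) ⊗ μ')`, `κ > 0`, for Haar measures `ν`, `μ_v`, `μ'` on
  `D_𝔸ˣ`, `D_vˣ`, `D^{S,×}` (uniqueness of Haar measure);
  `Quat.integral_prod_mul_eq_smul_prod_integral_mul_integral` — factorizable integrands factor;
* `Quat.posRealCentral_mem_trivialAt`, `Quat.center'_le_trivialAt`,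
  `Quat.placesSplitting_symm_posRealCentral` — **the split centre `A_{G'} = ℝ_{>0}` lies in `D^{S,×}`**;
* `Quat.mem_centralizer_iff_placesSplitting_symm`, `Quat.map_placesSplitting_symm_centralizer` —
  **centralisers split**: `splitting⁻¹(C(g)) = (Π_{v ∈ S} C_{D_vˣ}(g_v)) × C_{D^{S,×}}(s_S g)`
  (`B'_𝔸 = (Π_{v ∈ S} B'_v) × B'^S`);
* `Quat.exists_integral_descConj_eq_smul_prod_mul` — **(10.19)'**: for `γ ∈ D_𝔸ˣ` with closed
  `B'_v = C_{D_vˣ}(γ_v)` (`v ∈ S`), `B'^S = C_{D^{S,×}}(s_S γ)` and non-zero invariant measures finite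
  on compact sets on the three kinds of coset spaces, one `c ≠ 0` gives, for every
  `Φ(ι_S(a) k) = (Π_v ξ_v(a_v)) Θ(k)`,
  `∫_{D_𝔸ˣ/C(γ)} Φ(yγy⁻¹) dμ = c (Π_{v ∈ S} ∫_{D_vˣ/B'_v} ξ_v(aγ_va⁻¹) dμ_v) ∫_{D^{S,×}/B'^S} Θ(k (s_Sγ) k⁻¹) dμ'`.

Statements are on `adelicUnits K D`, `completionUnits D v` (`QuaternionAlgebraAdelic`); local
compactness / second countability of `D_vˣ` and the Borel structures are instance hypotheses, as in
the one-place file. Not treated: the normalisation of `c`, the local evaluations (10.20)–(10.21),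
the identification `G'^S = G^S`. Part of the inline (D-0026) decomposition of
`Literature.NumberTheory.Automorphic.strong_multiplicity_one_quaternionUnits`.

## References

* S. Gelbart, *Automorphic forms on adele groups*, Ann. of Math. Studies 83 (1975), §10,
  pp. 153–155, (10.14), (10.19) [Gelbart1975].
* D. Bump, *Automorphic Forms and Representations* (1997), §3.3, Prop. 3.3.2 [Bump1997].
-/

noncomputable section

open MeasureTheory MeasureTheory.Measure NumberField IsDedekindDomain
open scoped NNReal ENNReal

universe u

namespace Literature.NumberTheory.Automorphic

open Literature.MeasureTheory.Group

/-! ### The Haar measure along the splitting -/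

section Haar

variable (K : Type) [Field K] [NumberField K] (D : Type u) [Ring D] [Algebra K D] [Module.Finite K D]
  (S : Finset (HeightOneSpectrum (𝓞 K)))

/-- **Factorisation of the Haar measure of `D_𝔸ˣ` along `D_Sˣ × D^{S,×}`, measure level** (Bump (1997),
§3.3, for `GL_n`; Gelbart (1975), p. 153, `G'_𝔸 = G'_S × G'^S`). For Haar measures `ν` on `D_𝔸ˣ`,
`μ_v` on `D_vˣ` (`v ∈ S`) and `μ'` on `D^{S,×}` there is `κ > 0` with
`(splitting⁻¹)_* ν = κ • ((⨂_v μ_v) ⊗ μ')` (the image of `ν` is a Haar measure on the product, hence a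
positive multiple of the product Haar measure). [cite: Bump1997, §3.3 Prop. 3.3.2] [cite: Gelbart1975, §10 p. 153] -/
theorem Quat.exists_map_placesSplitting_symm_eq_smul_prod
    [MeasurableSpace (adelicUnits K D)] [BorelSpace (adelicUnits K D)]
    [∀ v : HeightOneSpectrum (𝓞 K), MeasurableSpace (completionUnits D v)]
    [∀ v : HeightOneSpectrum (𝓞 K), BorelSpace (completionUnits D v)]
    [∀ v : HeightOneSpectrum (𝓞 K), SecondCountableTopology (completionUnits D v)]
    [∀ v : HeightOneSpectrum (𝓞 K), LocallyCompactSpace (completionUnits D v)]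
    (ν : Measure (adelicUnits K D)) [ν.IsHaarMeasure]
    (μ : ∀ v : S, Measure (completionUnits D (v : HeightOneSpectrum (𝓞 K)))) [∀ v, (μ v).IsHaarMeasure]
    (μ' : Measure (Quat.trivialAt K D S)) [μ'.IsHaarMeasure] :
    ∃ κ : ℝ≥0, 0 < κ ∧ Measure.map (Quat.placesSplitting K D S).symm ν = κ • (Measure.pi μ).prod μ' := by
  haveI : LocallyCompactSpace (AdeleRing (𝓞 K) K) := locallyCompactSpace_adeleRing' K
  haveI : T2Space (AdeleRing (𝓞 K) K) := t2Space_adeleRing K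
  haveI : LocallyCompactSpace (adelicUnits K D) := inferInstance
  haveI : T2Space (adelicUnits K D) := inferInstance
  haveI : SecondCountableTopology (adelicUnits K D) := by
    haveI := secondCountableTopology_adeleRing K
    haveI : SecondCountableTopology (ScalarExtension K (AdeleRing (𝓞 K) K) D) :=
      (ScalarExtension.coordHomeomorph K (AdeleRing (𝓞 K) K) D).secondCountableTopology
    haveI : SecondCountableTopology (ScalarExtension K (AdeleRing (𝓞 K) K) D)ᵐᵒᵖ :=
      MulOpposite.opHomeomorph.symm.secondCountableTopology
    exact Units.isEmbedding_embedProduct.secondCountableTopology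
  haveI : ∀ v : HeightOneSpectrum (𝓞 K), T2Space (completionUnits D v) := fun v => inferInstance
  haveI : BorelSpace (Quat.trivialAt K D S) := Subtype.borelSpace _
  haveI : SecondCountableTopology (Quat.trivialAt K D S) := TopologicalSpace.Subtype.secondCountableTopology _
  haveI : BorelSpace (Quat.LocalPi K D S) := Pi.borelSpace
  haveI : BorelSpace (Quat.LocalPi K D S × Quat.trivialAt K D S) := Prod.borelSpace
  haveI : LocallyCompactSpace (Quat.trivialAt K D S) :=
    (Quat.isClosed_trivialAt K D S).isClosedEmbedding_subtypeVal.locallyCompactSpace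
  haveI : SigmaCompactSpace (Quat.trivialAt K D S) := sigmaCompactSpace_of_locallyCompact_secondCountable
  haveI : ∀ v : S, SigmaCompactSpace (completionUnits D (v : HeightOneSpectrum (𝓞 K))) :=
    fun v => sigmaCompactSpace_of_locallyCompact_secondCountable
  haveI : SFinite μ' := inferInstance
  haveI : ∀ v : S, SigmaFinite (μ v) := fun v => inferInstance
  set e := (Quat.placesSplitting K D S).symm with he
  haveI : ((Measure.pi μ).prod μ').IsHaarMeasure := inferInstance
  haveI : (Measure.map e ν).IsHaarMeasure := e.toMulEquiv.isHaarMeasure_map ν e.continuous e.symm.continuous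
  refine ⟨(Measure.map e ν).haarScalarFactor ((Measure.pi μ).prod μ'),
    haarScalarFactor_pos_of_isHaarMeasure _ _, ?_⟩
  exact isMulLeftInvariant_eq_smul (Measure.map e ν) ((Measure.pi μ).prod μ')

variable {K D S}

/-- **Factorizable integrands factor** (Bump (1997), Prop. 3.3.2; the mechanism of (10.19)'): if
`(splitting⁻¹)_* ν = κ • ((⨂_{v ∈ S} μ_v) ⊗ μ')` then for all complex `ξ_v` on `D_vˣ` (`v ∈ S`) and `θ`
on `D^{S,×}`, `∫_{D_𝔸ˣ} (Π_{v ∈ S} ξ_v(x_v)) θ(s_S x) dν(x) = κ (Π_{v ∈ S} ∫ ξ_v dμ_v) ∫ θ dμ'`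
(no integrability needed). [cite: Bump1997, §3.3 Prop. 3.3.2] [cite: Gelbart1975, p. 155 (10.19)] -/
theorem Quat.integral_prod_mul_eq_smul_prod_integral_mul_integral
    [MeasurableSpace (adelicUnits K D)] [BorelSpace (adelicUnits K D)]
    [∀ v : HeightOneSpectrum (𝓞 K), MeasurableSpace (completionUnits D v)]
    [∀ v : HeightOneSpectrum (𝓞 K), BorelSpace (completionUnits D v)]
    [∀ v : HeightOneSpectrum (𝓞 K), SecondCountableTopology (completionUnits D v)]
    (ν : Measure (adelicUnits K D))
    (μ : ∀ v : S, Measure (completionUnits D (v : HeightOneSpectrum (𝓞 K))))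
    (μ' : Measure (Quat.trivialAt K D S)) [∀ v, SigmaFinite (μ v)] [SFinite μ'] {κ : ℝ≥0}
    (hmap : Measure.map (Quat.placesSplitting K D S).symm ν = κ • (Measure.pi μ).prod μ')
    (ξ : ∀ v : S, completionUnits D (v : HeightOneSpectrum (𝓞 K)) → ℂ) (θ : Quat.trivialAt K D S → ℂ) :
    ∫ x, (∏ v : S, ξ v (toCompletionUnits K D (v : HeightOneSpectrum (𝓞 K)) x)) *
        θ ((Quat.placesSplitting K D S).symm x).2 ∂ν =
      κ • ((∏ v : S, ∫ t, ξ v t ∂(μ v)) * ∫ c, θ c ∂μ') := by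
  haveI : T2Space (AdeleRing (𝓞 K) K) := t2Space_adeleRing K
  haveI : T2Space (adelicUnits K D) := inferInstance
  haveI : BorelSpace (Quat.trivialAt K D S) := Subtype.borelSpace _
  haveI : BorelSpace (Quat.LocalPi K D S) := Pi.borelSpace
  haveI : BorelSpace (Quat.LocalPi K D S × Quat.trivialAt K D S) := Prod.borelSpace
  set e := (Quat.placesSplitting K D S).symm with he
  let em : adelicUnits K D ≃ᵐ Quat.LocalPi K D S × Quat.trivialAt K D S := e.toHomeomorph.toMeasurableEquiv
  have hem : ∀ x, em x = e x := fun _ => rfl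
  have hmap' : Measure.map em ν = κ • (Measure.pi μ).prod μ' := hmap
  have h1 := integral_map_equiv (μ := ν) em (fun p => (∏ v : S, ξ v (p.1 v)) * θ p.2)
  simp only [hem] at h1
  change ∫ x, (∏ v : S, ξ v ((e x).1 v)) * θ (e x).2 ∂ν = _
  rw [← h1, hmap', integral_smul_nnreal_measure,
    integral_prod_mul (μ := Measure.pi μ) (ν := μ') (fun a : Quat.LocalPi K D S => ∏ v : S, ξ v (a v)) θ,
    integral_fintype_prod_eq_prod]

end Haar

/-! ### The split centre lies in `D^{S,×}` -/

section Center

variable {K : Type} [Field K] [NumberField K] {D : Type u} [Ring D] [Algebra K D]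
  {S : Finset (HeightOneSpectrum (𝓞 K))}

/-- The positive real central elements lie in `D^{S,×}` (they are trivial at every finite place,
`Quat.toCompletionUnits_posRealCentral`). [folklore] -/
theorem Quat.posRealCentral_mem_trivialAt (t : ℝ≥0ˣ) : posRealCentral K D t ∈ Quat.trivialAt K D S :=
  Quat.mem_trivialAt_iff.2 fun _ _ => Quat.toCompletionUnits_posRealCentral t

variable (K D S) in
/-- **`A_{G'} = ℝ_{>0} ≤ D^{S,×}`**: the split centre `(units K D).center'` of the adelic datum is
contained in the subgroup of units trivial at the places of `S`. [folklore] -/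
theorem Quat.center'_le_trivialAt [Module.Finite K D] :
    (AdelicGroupData.units K D).center' ≤ Quat.trivialAt K D S := by
  rintro _ ⟨t, rfl⟩
  exact Quat.posRealCentral_mem_trivialAt t

/-- The splitting of a positive real central element: `splitting⁻¹(z(t)) = (1, z(t))`. [folklore] -/
theorem Quat.placesSplitting_symm_posRealCentral [Module.Finite K D] (t : ℝ≥0ˣ) :
    (Quat.placesSplitting K D S).symm (posRealCentral K D t) =
      (1, ⟨posRealCentral K D t, Quat.posRealCentral_mem_trivialAt t⟩) :=
  Prod.ext (funext fun _ => Quat.toCompletionUnits_posRealCentral t)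
    (Subtype.ext (Quat.awayFromPlaces_eq_self_of_mem (Quat.posRealCentral_mem_trivialAt t)))

end Center

/-! ### Centralisers split -/

section Centralizer

variable {K : Type} [Field K] [NumberField K] {D : Type u} [Ring D] [Algebra K D] [Module.Finite K D]
  {S : Finset (HeightOneSpectrum (𝓞 K))}

/-- **Centralisers split** (Gelbart (1975), p. 154: `B'_𝔸 = (Π_{v ∈ S} B'_v) × B'^S` for the tori of
(10.19)'): `h ∈ C(g)` iff `h_v ∈ C_{D_vˣ}(g_v)` for all `v ∈ S` and `s_S(h) ∈ C_{D^{S,×}}(s_S(g))`.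
[cite: Gelbart1975, p. 155 (10.19)] -/
theorem Quat.mem_centralizer_iff_placesSplitting_symm (g h : adelicUnits K D) :
    h ∈ Subgroup.centralizer ({g} : Set (adelicUnits K D)) ↔
      (∀ v : S, toCompletionUnits K D (v : HeightOneSpectrum (𝓞 K)) h ∈
          Subgroup.centralizer ({toCompletionUnits K D (v : HeightOneSpectrum (𝓞 K)) g} :
            Set (completionUnits D (v : HeightOneSpectrum (𝓞 K))))) ∧
        ((Quat.placesSplitting K D S).symm h).2 ∈
          Subgroup.centralizer ({((Quat.placesSplitting K D S).symm g).2} : Set (Quat.trivialAt K D S)) := by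
  rw [← mulEquiv_apply_mem_centralizer_singleton_iff (Quat.placesSplitting K D S).symm.toMulEquiv g h]
  change (Quat.placesSplitting K D S).symm h ∈ Subgroup.centralizer {(Quat.placesSplitting K D S).symm g} ↔ _
  rw [show (Quat.placesSplitting K D S).symm g =
      (((Quat.placesSplitting K D S).symm g).1, ((Quat.placesSplitting K D S).symm g).2) from rfl,
    centralizer_singleton_prod_eq, Subgroup.mem_prod, centralizer_singleton_pi_eq, Subgroup.mem_pi]
  simp only [Set.mem_univ, true_imp_iff]
  rfl

/-- **The image of a centraliser under the splitting**:
`splitting⁻¹(C(g)) = (Π_{v ∈ S} C_{D_vˣ}(g_v)) × C_{D^{S,×}}(s_S g)` as subgroups of `D_Sˣ × D^{S,×}`.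
[cite: Gelbart1975, p. 155 (10.19)] -/
theorem Quat.map_placesSplitting_symm_centralizer (g : adelicUnits K D) :
    (Subgroup.centralizer ({g} : Set (adelicUnits K D))).map
        (Quat.placesSplitting K D S).symm.toMulEquiv.toMonoidHom =
      (Subgroup.pi Set.univ fun v : S =>
          Subgroup.centralizer ({toCompletionUnits K D (v : HeightOneSpectrum (𝓞 K)) g} :
            Set (completionUnits D (v : HeightOneSpectrum (𝓞 K))))).prod
        (Subgroup.centralizer ({((Quat.placesSplitting K D S).symm g).2} : Set (Quat.trivialAt K D S))) := by
  ext p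
  rw [Subgroup.mem_map]
  constructor
  · rintro ⟨h, hh, rfl⟩
    have hh' := (Quat.mem_centralizer_iff_placesSplitting_symm (S := S) g h).1 hh
    refine (Subgroup.mem_prod).2 ⟨(Subgroup.mem_pi _).2 fun v _ => hh'.1 v, hh'.2⟩
  · intro hp
    refine ⟨Quat.placesSplitting K D S p, ?_, (Quat.placesSplitting K D S).symm_apply_apply p⟩
    have h1 : (Quat.placesSplitting K D S).symm (Quat.placesSplitting K D S p) = p :=
      (Quat.placesSplitting K D S).symm_apply_apply p
    have h2 := (Quat.mem_centralizer_iff_placesSplitting_symm (S := S) g (Quat.placesSplitting K D S p)).2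
    refine h2 ⟨fun v => ?_, ?_⟩
    · rw [show toCompletionUnits K D (v : HeightOneSpectrum (𝓞 K)) (Quat.placesSplitting K D S p) = p.1 v from
        congrFun (congrArg Prod.fst h1) v]
      exact (Subgroup.mem_pi _).1 ((Subgroup.mem_prod).1 hp).1 v (Set.mem_univ _)
    · rw [show ((Quat.placesSplitting K D S).symm (Quat.placesSplitting K D S p)).2 = p.2 from congrArg Prod.snd h1]
      exact ((Subgroup.mem_prod).1 hp).2

end Centralizer

/-! ### (10.19)': orbital integrals of factorizable functions on `D_𝔸ˣ` factor over `S` and away from `S` -/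

section Orbital

variable {K : Type} [Field K] [NumberField K] {D : Type u} [Ring D] [Algebra K D] [Module.Finite K D]
  {S : Finset (HeightOneSpectrum (𝓞 K))}

/-- **Gelbart's (10.19) on the `Dˣ` side for a finite set `S` of finite places**: for `γ ∈ D_𝔸ˣ` with
components `γ_v ∈ D_vˣ` (`v ∈ S`) and `γ^S = s_S(γ) ∈ D^{S,×}` whose centralisers
`B'_v = C_{D_vˣ}(γ_v)` and `B'^S = C_{D^{S,×}}(γ^S)` are closed, and non-zero invariant measures `μ`,
`μ_v`, `μ'` on `D_𝔸ˣ ⧸ C(γ)`, `D_vˣ ⧸ B'_v`, `D^{S,×} ⧸ B'^S` finite on compact sets, there is one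
`c ≠ 0` such that for every factorizable `Φ` — `Φ(ι_S(a) k) = (Π_{v ∈ S} ξ_v(a_v)) Θ(k)` for
`a ∈ D_Sˣ`, `k ∈ D^{S,×}` — the orbital integral factors:
`∫_{D_𝔸ˣ/C(γ)} Φ(y γ y⁻¹) dμ = c (Π_{v ∈ S} ∫_{D_vˣ/B'_v} ξ_v(a γ_v a⁻¹) dμ_v) ∫_{D^{S,×}/B'^S} Θ(k γ^S k⁻¹) dμ'`
(Gelbart p. 154: the orbital integrals of `Φ'_f = (⊗_{v ∈ S} f'_v) ⊗ (f * f^*)` in (10.14) are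
`{Π_{v ∈ S} ∫ f'_v} ∫_{B_S \ G'_S} f * f^*(x⁻¹ γ x) dx`; left cosets, `y = x⁻¹`;
`exists_integral_descConj_eq_smul_prod_mul` of `InvariantQuotientOrbitalPiProd` for the splitting
`Quat.placesSplitting K D S`). [cite: Gelbart1975, pp. 154–155 (10.14), (10.19)] -/
theorem Quat.exists_integral_descConj_eq_smul_prod_mul
    [∀ v : HeightOneSpectrum (𝓞 K), MeasurableSpace (completionUnits D v)]
    [∀ v : HeightOneSpectrum (𝓞 K), BorelSpace (completionUnits D v)]
    [∀ v : HeightOneSpectrum (𝓞 K), SecondCountableTopology (completionUnits D v)]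
    [∀ v : HeightOneSpectrum (𝓞 K), LocallyCompactSpace (completionUnits D v)]
    (γ : adelicUnits K D)
    (hC : ∀ v : S, IsClosed ((Subgroup.centralizer ({toCompletionUnits K D (v : HeightOneSpectrum (𝓞 K)) γ} :
      Set (completionUnits D (v : HeightOneSpectrum (𝓞 K)))) : Set (completionUnits D (v : HeightOneSpectrum (𝓞 K))))))
    (hC' : IsClosed ((Subgroup.centralizer ({((Quat.placesSplitting K D S).symm γ).2} :
      Set (Quat.trivialAt K D S))) : Set (Quat.trivialAt K D S)))
    [MeasurableSpace (adelicUnits K D ⧸ Subgroup.centralizer ({γ} : Set (adelicUnits K D)))]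
    [BorelSpace (adelicUnits K D ⧸ Subgroup.centralizer ({γ} : Set (adelicUnits K D)))]
    [∀ v : S, MeasurableSpace (completionUnits D (v : HeightOneSpectrum (𝓞 K)) ⧸
      Subgroup.centralizer ({toCompletionUnits K D (v : HeightOneSpectrum (𝓞 K)) γ} :
        Set (completionUnits D (v : HeightOneSpectrum (𝓞 K)))))]
    [∀ v : S, BorelSpace (completionUnits D (v : HeightOneSpectrum (𝓞 K)) ⧸
      Subgroup.centralizer ({toCompletionUnits K D (v : HeightOneSpectrum (𝓞 K)) γ} :
        Set (completionUnits D (v : HeightOneSpectrum (𝓞 K)))))]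
    [MeasurableSpace (Quat.trivialAt K D S ⧸
      Subgroup.centralizer ({((Quat.placesSplitting K D S).symm γ).2} : Set (Quat.trivialAt K D S)))]
    [BorelSpace (Quat.trivialAt K D S ⧸
      Subgroup.centralizer ({((Quat.placesSplitting K D S).symm γ).2} : Set (Quat.trivialAt K D S)))]
    (μ : Measure (adelicUnits K D ⧸ Subgroup.centralizer ({γ} : Set (adelicUnits K D))))
    [SMulInvariantMeasure (adelicUnits K D) _ μ] [IsFiniteMeasureOnCompacts μ]
    (μv : ∀ v : S, Measure (completionUnits D (v : HeightOneSpectrum (𝓞 K)) ⧸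
      Subgroup.centralizer ({toCompletionUnits K D (v : HeightOneSpectrum (𝓞 K)) γ} :
        Set (completionUnits D (v : HeightOneSpectrum (𝓞 K))))))
    [∀ v : S, SMulInvariantMeasure (completionUnits D (v : HeightOneSpectrum (𝓞 K))) _ (μv v)]
    [∀ v, IsFiniteMeasureOnCompacts (μv v)] [∀ v, SigmaFinite (μv v)]
    (μ' : Measure (Quat.trivialAt K D S ⧸
      Subgroup.centralizer ({((Quat.placesSplitting K D S).symm γ).2} : Set (Quat.trivialAt K D S))))
    [SMulInvariantMeasure (Quat.trivialAt K D S) _ μ'] [IsFiniteMeasureOnCompacts μ'] [SFinite μ']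
    (hμ : μ ≠ 0) (hv : ∀ v, μv v ≠ 0) (h' : μ' ≠ 0) :
    ∃ c : ℝ≥0, c ≠ 0 ∧ ∀ (Φ : adelicUnits K D → ℂ)
      (ξ : ∀ v : S, completionUnits D (v : HeightOneSpectrum (𝓞 K)) → ℂ) (Θ : Quat.trivialAt K D S → ℂ),
      (∀ (a : Quat.LocalPi K D S) (k : Quat.trivialAt K D S),
          Φ (Quat.toAdelicPi K D S a * (k : adelicUnits K D)) = (∏ v : S, ξ v (a v)) * Θ k) →
        ∫ y, descConj γ (Subgroup.centralizer ({γ} : Set (adelicUnits K D)))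
            (Literature.MeasureTheory.Group.centralizer_comm γ) Φ y ∂μ =
          c • ((∏ v : S, ∫ x, descConj (toCompletionUnits K D (v : HeightOneSpectrum (𝓞 K)) γ) _
              (Literature.MeasureTheory.Group.centralizer_comm _) (ξ v) x ∂(μv v)) *
            ∫ x, descConj ((Quat.placesSplitting K D S).symm γ).2 _
              (Literature.MeasureTheory.Group.centralizer_comm _) Θ x ∂μ') := by
  haveI : LocallyCompactSpace (AdeleRing (𝓞 K) K) := locallyCompactSpace_adeleRing' K
  haveI : T2Space (AdeleRing (𝓞 K) K) := t2Space_adeleRing K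
  haveI : LocallyCompactSpace (adelicUnits K D) := inferInstance
  haveI : T2Space (adelicUnits K D) := inferInstance
  haveI : SecondCountableTopology (adelicUnits K D) := by
    haveI := secondCountableTopology_adeleRing K
    haveI : SecondCountableTopology (ScalarExtension K (AdeleRing (𝓞 K) K) D) :=
      (ScalarExtension.coordHomeomorph K (AdeleRing (𝓞 K) K) D).secondCountableTopology
    haveI : SecondCountableTopology (ScalarExtension K (AdeleRing (𝓞 K) K) D)ᵐᵒᵖ :=
      MulOpposite.opHomeomorph.symm.secondCountableTopology
    exact Units.isEmbedding_embedProduct.secondCountableTopology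
  haveI : ∀ v : HeightOneSpectrum (𝓞 K), T2Space (completionUnits D v) := fun v => inferInstance
  haveI : SecondCountableTopology (Quat.trivialAt K D S) := TopologicalSpace.Subtype.secondCountableTopology _
  haveI : LocallyCompactSpace (Quat.trivialAt K D S) :=
    (Quat.isClosed_trivialAt K D S).isClosedEmbedding_subtypeVal.locallyCompactSpace
  have hγ : (Quat.placesSplitting K D S).toMulEquiv
      ((fun v : S => toCompletionUnits K D (v : HeightOneSpectrum (𝓞 K)) γ), ((Quat.placesSplitting K D S).symm γ).2) = γ :=
    (Quat.placesSplitting K D S).apply_symm_apply γ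
  exact Literature.MeasureTheory.Group.exists_integral_descConj_eq_smul_prod_mul
    (Quat.placesSplitting K D S).toMulEquiv (Quat.placesSplitting K D S).continuous
    (Quat.placesSplitting K D S).symm.continuous hγ hC hC' μ μv μ' hμ hv h'

end Orbital

end Literature.NumberTheory.Automorphic
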